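import Summits.AtomisticToContinuum.BoseEinsteinCondensation.Theorems.BECConjugateDominationHardCoreExtensionNearMinTower
import Summits.AtomisticToContinuum.BoseEinsteinCondensation.Theses.BECPeriodicReduction
import HarnessLib

/-!
# The residue of `HardCoreExtension` against the periodic conjunct `PeriodicBEC` (stmt-AtomisticToContinuum-0826)
# (crux `BECConjugateDomination.HardCoreExtension`, stmt-AtomisticToContinuum-11786 — line `near-minimiser-slack-transfer`, lead c7)

Two bookkeeping facts for the planners, both kernel-checked:

* `hardCoreExtension_of_periodicBEC` — the crux is SUBSUMED by two existing decls: `BECPeriodicReduction.PeriodicBEC` (near-minimiser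
  periodic BEC for every repulsive finite-range potential, stmt-0826) and `BoundaryTransferWeak` (stmt-0827) give the conjunct, hence
  `HardCoreExtension` (its antecedent unused);
* `periodicBEC_of_towerBECResidue` — the single registered obligation of this line's landed composition, `(∀ v admissible, T★(v))`
  (near-minimiser truncation-tower BEC), IMPLIES `PeriodicBEC` (the converse, hence the equivalence, is
  `towerBECResidue_iff_PeriodicBEC` of `…NearMinTowerNecessity.lean`, through the fixed-volume maximal-form density at hard cores).

So no line through approximating towers makes the crux cheaper than stmt-0826 at the singular potentials themselves.

References: E. H. Lieb, R. Seiringer, J. P. Solovej, J. Yngvason, *The Mathematics of the Bose Gas and its Condensation* (2005),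
§1.2 (1.19), Ch. 5 p. 42.
-/

noncomputable section

namespace Summit.AtomisticToContinuum.BoseEinsteinCondensation.Cruxes.HardCoreExtension.NearMinTower

open MeasureTheory Filter
open scoped ENNReal NNReal Topology
open Literature.MathematicalPhysics.QuantumManyBody.BoseGas
open Summit.AtomisticToContinuum.BoseEinsteinCondensation.Theses.BECConjugateDomination

/-- **`HardCoreExtension` is subsumed by stmt-0826 ∧ stmt-0827**: near-minimiser periodic BEC for every repulsive finite-range
potential and the weak boundary transfer give the conjunct, hence the crux (antecedent unused). [cite: LSSY2005, Ch. 5 p. 42] -/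
theorem hardCoreExtension_of_periodicBEC :
    Summit.AtomisticToContinuum.BoseEinsteinCondensation.Theses.BECPeriodicReduction.PeriodicBEC →
      BoundaryTransferWeak → HardCoreExtension :=
  fun hP hbt _ v hv => hbt v hv (hP v hv)

/-- **The line's residue implies the periodic conjunct** `PeriodicBEC` (stmt-0826), by the landed transfer
`periodicBEC_of_nearMinimiserTowerBEC` potential by potential. [cite: LSSY2005, §1.2 (1.19) and Ch. 5 p. 42] -/
theorem periodicBEC_of_towerBECResidue
    (hT : ∀ v : ℝ → ℝ≥0∞, IsRepulsiveFiniteRange v →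
      ∃ ρ₀ : ℝ, 0 < ρ₀ ∧ ∀ ρ : ℝ, 0 < ρ → ρ < ρ₀ → ∃ c : ℝ, 0 < c ∧ ∀ᶠ N : ℕ in atTop,
        ∃ δ : ℝ≥0∞, 0 < δ ∧ ∃ n₀ : ℕ, ∀ n : ℕ, n₀ ≤ n →
          ∀ Ψ : PeriodicTrialState N (sideLength ρ N),
            periodicEnergy (fun r => min (v r) (n : ℝ≥0∞)) Ψ ≤
                periodicGroundStateEnergy (fun r => min (v r) (n : ℝ≥0∞)) N (sideLength ρ N) + δ →
              ENNReal.ofReal (c * N) ≤ condensateOccupation N (sideLength ρ N) Ψ.ψ) :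
    Summit.AtomisticToContinuum.BoseEinsteinCondensation.Theses.BECPeriodicReduction.PeriodicBEC :=
  fun v hv => periodicBEC_of_nearMinimiserTowerBEC v hv (hT v hv)

end Summit.AtomisticToContinuum.BoseEinsteinCondensation.Cruxes.HardCoreExtension.NearMinTower

end
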